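import Summits.AnomalousDissipation.AnomalousDissipation.Theses.ImpulseGrid
import Literature.Analysis.FluidPDE.LerayHopfTimeSliceTorus
import Literature.Analysis.FluidPDE.NSLerayHopf

/-!
# Mean momentum balance of a global Leray–Hopf solution (route ImpulseGrid, item
stmt-AnomalousDissipation-1773 `MeanMomentumBalance`)

For a global Leray–Hopf solution `u` on `T³` driven by a steady smooth force `f` (viscosity
`ν > 0`), with `sup_{t ≥ 0} ½‖u(t)‖₂² ≤ C`, tested against a smooth steady divergence-free field
`Φ₀`, and any generalized (Banach) long-time limit `Λ`:

`Λ⟨∫⟪u,(u·∇)Φ₀⟫⟩ + ν Λ⟨∫⟪u,ΔΦ₀⟫⟩ + ∫⟪f,Φ₀⟫ = 0`.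

Proof (Foias–Manley–Rosa–Temam 2001, Ch. IV §3.1: `Lim T⁻¹[Φ(u(T)) − Φ(u(0))] = 0`;
Doering–Foias 2002, §2): the time-sliced weak formulation
(`Torus.IsLerayHopfOn.integral_inner_eq_add_setIntegral`, Temam 1984 Ch. III (1.25)) with the
test field `Φ₀` gives, for every `T > 0`,
`⟨u(T),Φ₀⟩ − ⟨u₀,Φ₀⟩ = ∫₀ᵀ (∫⟪u,(u·∇)Φ₀⟫ + ν∫⟪u,ΔΦ₀⟫ + ∫⟪f,Φ₀⟫) dt`;
the three slice functionals are integrable on `(0,T]`, so the Cesàro means satisfy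
`T⁻¹∫₀ᵀ A + ν T⁻¹∫₀ᵀ B + ∫⟪f,Φ₀⟫ = T⁻¹(⟨u(T),Φ₀⟩ − ⟨u₀,Φ₀⟩) → 0` (the pairing `⟨u(T),Φ₀⟩` is
bounded by the sup-energy hypothesis); finally `Λ` is linear and extends the limit at `+∞`
(`GeneralizedLimit.apply_eq_of_tendsto`).

No new definitions.
-/

noncomputable section

open MeasureTheory Set Filter Topology
open scoped InnerProductSpace RealInnerProductSpace

-- `Summit.<Summit>.<Problem>` is the tree's mandated summit-side namespace (CONVENTIONS §2); for this
-- single-conjunct summit the two coincide, so the duplicate is deliberate.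
set_option linter.dupNamespace false

namespace Summit.AnomalousDissipation.AnomalousDissipation.Theorems

open Literature.Analysis.FunctionSpaces Literature.Analysis.FunctionSpaces.Torus
open Literature.Analysis.FluidPDE Literature.Analysis.FluidPDE.Torus

variable {ν : ℝ} {f Φ₀ u₀ : UnitAddTorus (Fin 3) → EuclideanSpace ℝ (Fin 3)}
  {u : ℝ → UnitAddTorus (Fin 3) → EuclideanSpace ℝ (Fin 3)}

/-- **Finite-time momentum balance** of a global Leray–Hopf solution under a steady smooth force,
tested against a smooth divergence-free field `Φ₀`: for every `T > 0`,
`∫₀ᵀ ∫⟪u,(u·∇)Φ₀⟫ + ν ∫₀ᵀ ∫⟪u,ΔΦ₀⟫ + T ∫⟪f,Φ₀⟫ = ⟨u(T),Φ₀⟩ − ⟨u₀,Φ₀⟩`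
(the time-sliced weak formulation `Torus.IsLerayHopfOn.integral_inner_eq_add_setIntegral`,
Temam 1984 Ch. III (1.25), with the flux split into its three integrable pieces). [folklore] -/
theorem impulseGrid_momentum_balance_Ioc (hf : IsSmooth f) (hΦ : IsSmooth Φ₀)
    (hΦd : IsDivFree Φ₀) (hu : Torus.IsGlobalLerayHopf ν (fun _ => f) u₀ u) {T : ℝ}
    (hT : 0 < T) :
    (∫ t in Ioc 0 T, ∫ x, ⟪u t x, convect (u t) Φ₀ x⟫) +
        ν * (∫ t in Ioc 0 T, ∫ x, ⟪u t x, laplacian Φ₀ x⟫) + T * ∫ x, ⟪f x, Φ₀ x⟫ =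
      (∫ x, ⟪u T x, Φ₀ x⟫) - ∫ x, ⟪u₀ x, Φ₀ x⟫ := by
  set A : ℝ → ℝ := fun t => ∫ x, ⟪u t x, convect (u t) Φ₀ x⟫ with hA
  set B : ℝ → ℝ := fun t => ∫ x, ⟪u t x, laplacian Φ₀ x⟫ with hB
  set Cf : ℝ := ∫ x, ⟪f x, Φ₀ x⟫ with hCf
  set flux : ℝ → ℝ := fun s =>
    ∫ x, (⟪u s x, convect (u s) Φ₀ x⟫ + ν * ⟪u s x, laplacian Φ₀ x⟫ + ⟪f x, Φ₀ x⟫) with hflux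
  have hfm : AEStronglyMeasurable (stLift fun _ : ℝ => f) (volume.restrict (Ioo 0 T ×ˢ univ)) :=
    aestronglyMeasurable_stLift_const hf _
  have hf₂ : ∫⁻ _ in Ioo (0 : ℝ) T, ∫⁻ x, ‖f x‖ₑ ^ 2 < ⊤ := lintegral_enorm_sq_const_lt_top hf T
  -- the time-sliced weak formulation tested with `Φ₀`
  have hid : ∫ x, ⟪u T x, Φ₀ x⟫ = (∫ x, ⟪u₀ x, Φ₀ x⟫) + ∫ s in Ioc 0 T, flux s :=
    (hu T hT).integral_inner_eq_add_setIntegral hT hfm hf₂ hΦ hΦd ⟨hT, le_rfl⟩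
  -- splitting the flux on every slice `s ≥ 0`
  have hsplit : ∀ s ∈ Ioc (0 : ℝ) T, flux s = A s + ν * B s + Cf := by
    intro s hs
    have hmem : MemLp (u s) 2 volume := (hu T hT).memLp s ⟨hs.1.le, hs.2⟩
    have i1 : Integrable (fun x => ⟪u s x, convect (u s) Φ₀ x⟫) volume :=
      integrable_inner_convect_self hmem hΦ
    have i2 : Integrable (fun x => ⟪u s x, laplacian Φ₀ x⟫) volume :=
      integrable_inner_of_continuous (hmem.integrable one_le_two) hΦ.laplacian.continuous
    have i3 : Integrable (fun x => ⟪f x, Φ₀ x⟫) volume :=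
      integrable_inner_of_continuous hf.integrable hΦ.continuous
    have i12 : Integrable (fun x => ⟪u s x, convect (u s) Φ₀ x⟫ + ν * ⟪u s x, laplacian Φ₀ x⟫)
        volume := i1.add (i2.const_mul ν)
    simp only [hflux, hA, hB, hCf]
    rw [integral_add i12 i3, integral_add i1 (i2.const_mul ν), integral_const_mul]
  -- integrability in time of the three pieces
  have hfluxInt : IntegrableOn flux (Ioc 0 T) :=
    (integrableOn_Ioc_iff_integrableOn_Ioo).2 ((hu T hT).integrableOn_flux hfm hf₂ hΦ)
  have hBInt : IntegrableOn B (Ioc 0 T) :=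
    (integrableOn_Ioc_iff_integrableOn_Ioo).2
      ((hu T hT).integrableOn_integral_inner hΦ.laplacian.continuous)
  have hconstInt : IntegrableOn (fun _ : ℝ => Cf) (Ioc 0 T) :=
    integrableOn_const (hs := measure_Ioc_lt_top.ne)
  have hAInt : IntegrableOn A (Ioc 0 T) := by
    have h : IntegrableOn (fun s => flux s - (ν * B s + Cf)) (Ioc 0 T) :=
      hfluxInt.sub ((hBInt.const_mul ν).add hconstInt)
    refine h.congr_fun (fun s hs => ?_) measurableSet_Ioc
    show flux s - (ν * B s + Cf) = A s
    rw [hsplit s hs]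
    ring
  -- integrate the split flux
  have hABInt : IntegrableOn (fun s => A s + ν * B s) (Ioc 0 T) := hAInt.add (hBInt.const_mul ν)
  have e1 : ∫ s in Ioc 0 T, (A s + ν * B s + Cf) =
      (∫ s in Ioc 0 T, (A s + ν * B s)) + ∫ _ in Ioc 0 T, Cf := integral_add hABInt hconstInt
  have e2 : ∫ s in Ioc 0 T, (A s + ν * B s) = (∫ s in Ioc 0 T, A s) + ∫ s in Ioc 0 T, ν * B s :=
    integral_add hAInt (hBInt.const_mul ν)
  have e3 : ∫ s in Ioc 0 T, ν * B s = ν * ∫ s in Ioc 0 T, B s := integral_const_mul ν B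
  have e4 : ∫ _ in Ioc 0 T, Cf = T * Cf := by
    rw [setIntegral_const, Real.volume_real_Ioc_of_le hT.le, sub_zero, smul_eq_mul]
  have hint : ∫ s in Ioc 0 T, flux s =
      (∫ s in Ioc 0 T, A s) + ν * (∫ s in Ioc 0 T, B s) + T * Cf := by
    rw [setIntegral_congr_fun measurableSet_Ioc hsplit, e1, e2, e3, e4]
  rw [hid, hint]
  ring

/-- **Uniform bound on the tested momentum** `|⟨u(t),Φ₀⟩| ≤ K(1 + 2C)/2` for `t ≥ 0`, when
`‖Φ₀‖ ≤ K` pointwise and `½‖u(t)‖₂² ≤ C` for all `t ≥ 0` (`‖u‖ ≤ ½(1 + ‖u‖²)` pointwise on the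
probability space `T³`). [folklore] -/
theorem impulseGrid_abs_integral_inner_le (hu : Torus.IsGlobalLerayHopf ν (fun _ => f) u₀ u)
    {K : ℝ} (hK0 : 0 ≤ K) (hK : ∀ x, ‖Φ₀ x‖ ≤ K) {C : ℝ}
    (hC : ∀ t : ℝ, 0 ≤ t → kineticEnergy (u t) ≤ C) {t : ℝ} (ht : 0 ≤ t) :
    |∫ x, ⟪u t x, Φ₀ x⟫| ≤ K * (2⁻¹ * (1 + 2 * C)) := by
  have hmem : MemLp (u t) 2 volume := (hu (t + 1) (by linarith)).memLp t ⟨ht, by linarith⟩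
  have h1 := abs_integral_inner_le_of_norm_le (hmem.integrable one_le_two) hK
  have h2 := integral_norm_le_of_memLp_two hmem
  have h3 : ∫ x, ‖u t x‖ ^ 2 ≤ 2 * C := by
    have h := hC t ht
    simp only [kineticEnergy] at h
    linarith
  calc |∫ x, ⟪u t x, Φ₀ x⟫| ≤ K * ∫ x, ‖u t x‖ := h1
    _ ≤ K * (2⁻¹ * (1 + ∫ x, ‖u t x‖ ^ 2)) := mul_le_mul_of_nonneg_left h2 hK0
    _ ≤ K * (2⁻¹ * (1 + 2 * C)) := by gcongr

/-- **Mean momentum balance** (closes item stmt-AnomalousDissipation-1773 of route ImpulseGrid):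
for a global Leray–Hopf solution `u` on `T³` under a steady smooth force `f`, `ν > 0`, with
`sup_{t ≥ 0} ½‖u(t)‖₂²` finite, a smooth steady divergence-free test field `Φ₀`, and any
generalized long-time limit `Λ`,
`Λ⟨∫⟪u,(u·∇)Φ₀⟫⟩ + ν Λ⟨∫⟪u,ΔΦ₀⟫⟩ + ∫⟪f,Φ₀⟫ = 0`
(Foias–Manley–Rosa–Temam 2001, Ch. IV §3.1; Doering–Foias 2002, §2: divide the finite-time
balance `impulseGrid_momentum_balance_Ioc` by `T`, the boundary term is `O(1/T)` by
`impulseGrid_abs_integral_inner_le`, and `Λ` is linear and extends `lim_{T→∞}`). [folklore] -/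
theorem meanMomentumBalance_proof :
    Summit.AnomalousDissipation.AnomalousDissipation.Theses.ImpulseGrid.MeanMomentumBalance := by
  intro Λ ν f Φ₀ u₀ u _hν hf hΦ hΦd hu hE
  obtain ⟨C, hC⟩ := hE
  obtain ⟨K, hK0, hK⟩ := exists_nonneg_forall_norm_le_of_continuous hΦ.continuous
  set A : ℝ → ℝ := fun t => ∫ x, ⟪u t x, convect (u t) Φ₀ x⟫ with hA
  set B : ℝ → ℝ := fun t => ∫ x, ⟪u t x, laplacian Φ₀ x⟫ with hB
  set Cf : ℝ := ∫ x, ⟪f x, Φ₀ x⟫ with hCf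
  set P : ℝ → ℝ := fun t => ∫ x, ⟪u t x, Φ₀ x⟫ with hP
  set P₀ : ℝ := ∫ x, ⟪u₀ x, Φ₀ x⟫ with hP₀
  set M : ℝ := K * (2⁻¹ * (1 + 2 * C)) with hM
  -- the boundary term is bounded
  have hPbd : ∀ t : ℝ, 0 ≤ t → |P t| ≤ M := fun t ht =>
    impulseGrid_abs_integral_inner_le hu hK0 hK hC ht
  -- the Cesàro identity for `T > 0`
  have hces : ∀ T : ℝ, 0 < T → timeMean A T + ν * timeMean B T + Cf = T⁻¹ * (P T - P₀) := by
    intro T hT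
    have h : (∫ t in Ioc 0 T, A t) + ν * (∫ t in Ioc 0 T, B t) + T * Cf = P T - P₀ :=
      impulseGrid_momentum_balance_Ioc hf hΦ hΦd hu hT
    have key : T⁻¹ * T = 1 := inv_mul_cancel₀ hT.ne'
    simp only [timeMean, intervalIntegral.integral_of_le hT.le]
    rw [← h]
    linear_combination (-Cf) * key
  -- the boundary term divided by `T` tends to zero
  have hlim : Tendsto (fun T : ℝ => T⁻¹ * (P T - P₀)) atTop (𝓝 0) := by
    have h1 : Tendsto (fun T : ℝ => (M + |P₀|) * T⁻¹) atTop (𝓝 0) := by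
      simpa using tendsto_inv_atTop_zero.const_mul (M + |P₀|)
    refine squeeze_zero_norm' ?_ h1
    filter_upwards [eventually_gt_atTop (0 : ℝ)] with T hT
    rw [Real.norm_eq_abs, abs_mul, abs_inv, abs_of_pos hT, mul_comm]
    refine mul_le_mul_of_nonneg_right ?_ (inv_nonneg.2 hT.le)
    exact (abs_sub _ _).trans (add_le_add (hPbd T hT.le) le_rfl)
  have hg : Tendsto (fun T : ℝ => timeMean A T + ν * timeMean B T + Cf) atTop (𝓝 0) := by
    refine hlim.congr' ?_
    filter_upwards [eventually_gt_atTop (0 : ℝ)] with T hT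
    exact (hces T hT).symm
  -- `Λ` is linear and extends the limit
  have hΛ : Λ (fun T : ℝ => timeMean A T + ν * timeMean B T + Cf) = 0 := Λ.apply_eq_of_tendsto hg
  have hfun : (fun T : ℝ => timeMean A T + ν * timeMean B T + Cf) =
      timeMean A + ν • timeMean B + fun _ => Cf := by
    funext T
    simp only [Pi.add_apply, Pi.smul_apply, smul_eq_mul]
  have hconst : Λ (fun _ : ℝ => Cf) = Cf := Λ.apply_eq_of_tendsto tendsto_const_nhds
  rw [hfun, map_add, map_add, map_smul, hconst, smul_eq_mul] at hΛ
  exact hΛ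

end Summit.AnomalousDissipation.AnomalousDissipation.Theorems

end
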